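import Literature.Probability.LatticeModels.AxisSpectralRepresentationProofs
import Summits.CriticalPhenomena.Ising3DConformalLimit.Theses.PerfectScreening

/-!
# The spectral measure of an axis FORM of the two-point function — finite volume
(route `PerfectScreening`, support item `MixedSpectralRepresentation`, helper file 1/2)

Route `PerfectScreening` of `CriticalPhenomena / Ising3DConformalLimit`, support item
`stmt-CriticalPhenomena-13893` (`MixedSpectralRepresentation` = Aizenman–Duminil-Copin 2021,
Prop. 5.3 / App. Prop. 8.6 for a finitely supported real `v` on the transverse plane). The tree
proves the AXIS case `v = δ_⊥` (`Literature/Probability/LatticeModels/AxisSpectralRepresentationProofs.lean`,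
`AizenmanDuminilCopin2021_prop_8_6_holds`); this file generalises its finite-volume half (Parts B–C
there) from the single spin `σ_{y₀}` to a layer observable `F = ∑_a c_a σ_{y_a}`:

* `MixedSpectral.exists_intertwiner_sum` — the intertwining relation `diag F · A = A · S'` for the
  symmetrised Ising transfer matrix `A` at `β > 0`, with `‖S' w‖² ≤ B ‖w‖²` and `B = B(β, d', c)`
  UNIFORM in the size `N` of the torus (sum of the single-spin intertwiners of the tree,
  Cauchy–Schwarz);
* `MixedSpectral.exists_torusFormMeasure` — on the torus `(ℤ/Nℤ)^{d'+1}`, `N ≥ 3`, the axis form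
  `W_N(n) = ∑_{a,b} c_a c_b ⟨σ_{x_a} σ_{x_b + n e_i}⟩_{𝕋_N;β}` (`torusAxisForm`) is the moment sequence
  `W_N(n) = ∫ λⁿ dν_N`, `0 ≤ n < N`, of a finitely supported positive measure `ν_N` on `[0, ∞)` with
  the no-atom bound `ν_N([0, δ]) ≤ B δ²` uniformly in `N` (transfer-matrix spectral decomposition
  `Z · W_N(n) = Tr(diag F · Aⁿ · diag F · A^{N-n})`, `Z_mul_torusAxisForm_eq_trace`, and the spectral
  weights with an intertwiner, `AxisSpectral.exists_spectralWeights_of_intertwiner`).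

The infinite-volume limit and the item itself are in the companion file
`PerfectScreeningMixedSpectralRepresentation.lean`.

References: M. Aizenman, H. Duminil-Copin, Ann. of Math. 194 (2021) = arXiv:1912.07973, §5.3
Prop. 5.3 and Appendix §8.3 Prop. 8.6 (proof: transfer matrix on periodic tubes, positivity,
eq. (212)); J. Glimm, A. Jaffe, *Quantum Physics* (1987) §6.1; T. D. Schultz, D. C. Mattis,
E. H. Lieb, Rev. Mod. Phys. 36 (1964) 856, §II.
-/

noncomputable section

namespace Summit.CriticalPhenomena.Ising3DConformalLimit.Theorems

namespace MixedSpectral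

open Matrix Finset _root_.MeasureTheory
open Literature.Probability.LatticeModels

/-! ### Part 1. The intertwiner of a linear combination of spins -/

/-- **Intertwiner of a layer observable.** For the symmetrised nearest-neighbour Ising transfer
matrix `A` at `β > 0` (zero field) and real coefficients `c_a`, there is `B = B(β, d', c) ≥ 0` such
that on EVERY torus `(ℤ/Nℤ)^{d'}` of layers and for every choice of sites `y_a` the observable
`F = ∑_a c_a σ_{y_a}` admits an intertwiner `diag F · A = A · S'` with `∑_r (S' w)_r² ≤ B ∑_r w_r²`:
`S' = ∑_a c_a S'_a` with the single-spin intertwiners `S'_a` of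
`AxisSpectral.exists_intertwiner`, and `B = |ι| · (∑_a c_a²) · B₁(β, d')` by Cauchy–Schwarz. [folklore] -/
theorem exists_intertwiner_sum {d' : ℕ} {β : ℝ} (hβ : 0 < β) {ι : Type*} [Fintype ι] (c : ι → ℝ) :
    ∃ B : ℝ, 0 ≤ B ∧ ∀ (N : ℕ) [NeZero N] (y : ι → TorusSite d' N),
      ∃ S' : Matrix (Layer d' N) (Layer d' N) ℝ,
        diagonal (fun r => ∑ a, c a * spinAt (y a) r) * transferMatrix β 0 = transferMatrix β 0 * S' ∧
        ∀ w : Layer d' N → ℝ, ∑ r, (S' *ᵥ w) r ^ 2 ≤ B * ∑ r, w r ^ 2 := by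
  classical
  set B₁ : ℝ := 2 * ((1 + Real.exp (-2 * β) ^ 2) ^ 2 + 4 * Real.exp (-2 * β) ^ 2 * Real.exp (2 * β * d') ^ 2) /
    (1 - Real.exp (-2 * β) ^ 2) ^ 2 with hB₁
  have hB₁0 : 0 ≤ B₁ := by positivity
  refine ⟨Fintype.card ι * (∑ a, c a ^ 2) * B₁, by positivity, fun N _ y => ?_⟩
  have h := fun a => AxisSpectral.exists_intertwiner (N := N) hβ (y a)
  choose S hS hB using h
  refine ⟨∑ a, c a • S a, ?_, fun w => ?_⟩
  · -- linearity of both sides in the observable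
    have hdiag : diagonal (fun r => ∑ a, c a * spinAt (y a) r) =
        ∑ a, c a • diagonal (fun r : Layer d' N => spinAt (y a) r) := by
      ext r r'
      simp only [Matrix.sum_apply, Matrix.smul_apply, Matrix.diagonal_apply, smul_eq_mul, mul_ite, mul_zero]
      split_ifs <;> simp
    rw [hdiag, Finset.sum_mul, Matrix.mul_sum]
    refine Finset.sum_congr rfl fun a _ => ?_
    rw [Matrix.smul_mul, Matrix.mul_smul, hS a]
  · have happly : ∀ r, ((∑ a, c a • S a) *ᵥ w) r = ∑ a, c a * (S a *ᵥ w) r := by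
      intro r
      simp only [Matrix.mulVec, dotProduct, Matrix.sum_apply, Matrix.smul_apply, smul_eq_mul, Finset.sum_mul,
        Finset.mul_sum]
      rw [Finset.sum_comm]
      exact Finset.sum_congr rfl fun a _ => Finset.sum_congr rfl fun r' _ => by ring
    have hc0 : 0 ≤ ∑ a, c a ^ 2 := Finset.sum_nonneg fun a _ => sq_nonneg _
    calc ∑ r, ((∑ a, c a • S a) *ᵥ w) r ^ 2 = ∑ r, (∑ a, c a * (S a *ᵥ w) r) ^ 2 := by simp_rw [happly]
      _ ≤ ∑ r, (∑ a, c a ^ 2) * ∑ a, (S a *ᵥ w) r ^ 2 :=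
          Finset.sum_le_sum fun r _ => Finset.sum_mul_sq_le_sq_mul_sq _ _ _
      _ = (∑ a, c a ^ 2) * ∑ a, ∑ r, (S a *ᵥ w) r ^ 2 := by rw [← Finset.mul_sum, Finset.sum_comm]
      _ ≤ (∑ a, c a ^ 2) * ∑ _a : ι, B₁ * ∑ r, w r ^ 2 := by
          refine mul_le_mul_of_nonneg_left (Finset.sum_le_sum fun a _ => ?_) hc0
          exact hB a w
      _ = Fintype.card ι * (∑ a, c a ^ 2) * B₁ * ∑ r, w r ^ 2 := by
          rw [Finset.sum_const, Finset.card_univ, nsmul_eq_mul]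
          ring

/-! ### Part 2. The finite-volume spectral measure of an axis form on the torus -/

/-- **The finite-volume spectral representation of an axis form, with the no-atom bound** (the
content of ADC 2021, App. 8.3, eq. (212) and "the positivity of the transfer matrix", on the tori
`(ℤ/Nℤ)^{d'+1}`, `N ≥ 3`, `β > 0`, for the layer observable `F = ∑_a c_a σ_{x_a}`): there is
`B = B(β, d', c) ≥ 0` such that for every `N ≥ 3`, axis `i` and sites `x_a` in the layer
`{x_i = 0}` there is a finitely supported positive measure
`ν_N = ∑_{k,l} (c_{kl} λ_k^N / Z) δ_{λ_l/λ_k}` on `[0, ∞)` with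
`∑_{a,b} c_a c_b ⟨σ_{x_a} σ_{x_b + n e_i}⟩_{𝕋_N;β} = ∫ λⁿ dν_N(λ)` for `0 ≤ n < N` and
`ν_N([0, δ]) ≤ B δ²` for all `δ ≥ 0`.
[cite: AizenmanDuminilCopinAnnals2021, Appendix §8.3, proof of Prop. 8.6, eq. (212)] -/
theorem exists_torusFormMeasure {β : ℝ} (hβ : 0 < β) (d' : ℕ) {ι : Type*} [Fintype ι] (c : ι → ℝ) :
    ∃ B : ℝ, 0 ≤ B ∧ ∀ (N : ℕ) [NeZero N], 3 ≤ N → ∀ (i : Fin (d' + 1)) (x : ι → TorusSite (d' + 1) N),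
      (∀ a, x a i = 0) →
      ∃ ν : Measure ℝ, IsFiniteMeasure ν ∧ ν (Set.Iio 0) = 0 ∧ (∀ n : ℕ, Integrable (fun t : ℝ => t ^ n) ν) ∧
        (∀ n : ℕ, n < N → ∫ t, t ^ n ∂ν = torusAxisForm β i c x (n : ZMod N)) ∧
        ∀ δ : ℝ, 0 ≤ δ → ν (Set.Icc 0 δ) ≤ ENNReal.ofReal (B * δ ^ 2) := by
  obtain ⟨B, hB0, hB⟩ := exists_intertwiner_sum (d' := d') hβ c
  refine ⟨B, hB0, fun N _ hN i x hx => ?_⟩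
  classical
  set y : ι → TorusSite d' N := fun a => i.removeNth (x a) with hy
  set A := transferMatrix (d' := d') (N := N) β 0 with hAdef
  have hA : A.PosSemidef := transferMatrix_posSemidef hβ.le 0
  set f : Layer d' N → ℝ := fun r => ∑ a, c a * spinAt (y a) r with hf
  obtain ⟨S', hS, hSB⟩ := hB N y
  obtain ⟨ev, cc, cc', hev, hcc, hcc', htrace, htrpow, hrel, hsumcc'⟩ :=
    AxisSpectral.exists_spectralWeights_of_intertwiner hA f S' hS B hSB
  -- the partition function and the axis form as two-insertion traces
  set Z := isingPartitionFunction (torusGraph (d' + 1) N) Finset.univ β 0 .free with hZdef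
  have hZpos : 0 < Z := isingPartitionFunction_pos _ _ β 0 _
  set u : ZMod N → ℝ := fun n => torusAxisForm β i c x n with hu
  have hZu : ∀ n : ZMod N, Z * u n = ∑ k, ∑ l, cc k l * (ev l ^ n.val * ev k ^ (N - n.val)) := by
    intro n
    have key := Z_mul_torusAxisForm_eq_trace hN β i c x hx n
    rw [hu, key]
    exact htrace n.val (N - n.val)
  -- `Z = Tr(A^N) = ∑_k λ_k^N`, from the single-spin form at `n = 0` (`σ² = 1`)
  have hZev : Z = ∑ k, ev k ^ N := by
    have key := Z_mul_torusAxisForm_eq_trace hN β i (fun _ : Fin 1 => (1 : ℝ))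
      (fun _ => (0 : TorusSite (d' + 1) N)) (fun _ => rfl) 0
    have hform : torusAxisForm β i (fun _ : Fin 1 => (1 : ℝ)) (fun _ => (0 : TorusSite (d' + 1) N)) 0 = 1 := by
      simp [torusAxisForm, isingTorusTwoPoint]
    set f₀ : Layer d' N → ℝ := fun r => spinAt (i.removeNth (0 : TorusSite (d' + 1) N)) r with hf₀
    have hdiag : (diagonal fun r : Layer d' N =>
        ∑ a : Fin 1, (1 : ℝ) * spinAt (i.removeNth ((fun _ : Fin 1 => (0 : TorusSite (d' + 1) N)) a)) r) =
        diagonal f₀ := by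
      congr 1; funext r; simp [hf₀]
    rw [hform, mul_one, hdiag, ZMod.val_zero, Nat.sub_zero, pow_zero, Matrix.mul_one, diagonal_mul_diagonal] at key
    have h1 : (fun r => f₀ r * f₀ r) = fun _ => (1 : ℝ) := funext fun r => spinAt_mul_self _ r
    rw [h1, diagonal_one, Matrix.one_mul, htrpow N] at key
    exact key
  -- weights and atoms of the spectral measure
  set w : Layer d' N → Layer d' N → ℝ := fun k l => cc k l * ev k ^ N / Z with hw
  set xs : Layer d' N → Layer d' N → ℝ := fun k l => ev l / ev k with hxs
  have hw0 : ∀ k l, 0 ≤ w k l := fun k l => div_nonneg (mul_nonneg (hcc k l) (pow_nonneg (hev k) N)) hZpos.le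
  have hxs0 : ∀ k l, 0 ≤ xs k l := fun k l => div_nonneg (hev l) (hev k)
  let ν : Measure ℝ := ∑ p : Layer d' N × Layer d' N, ENNReal.ofReal (w p.1 p.2) • Measure.dirac (xs p.1 p.2)
  have hνapply : ∀ s : Set ℝ, MeasurableSet s →
      ν s = ∑ p : Layer d' N × Layer d' N, ENNReal.ofReal (w p.1 p.2) * s.indicator 1 (xs p.1 p.2) := by
    intro s hs
    simp only [ν, Measure.coe_finsetSum, Finset.sum_apply, Measure.smul_apply, smul_eq_mul,
      Measure.dirac_apply' _ hs]
  have hint : ∀ g : ℝ → ℝ, Integrable g ν := fun g =>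
    integrable_finsetSum_measure.2 fun p _ =>
      (AxisSpectral.integrable_dirac_real g _).smul_measure ENNReal.ofReal_ne_top
  have hintegral : ∀ g : ℝ → ℝ, ∫ t, g t ∂ν = ∑ p : Layer d' N × Layer d' N, w p.1 p.2 * g (xs p.1 p.2) := by
    intro g
    rw [integral_finsetSum_measure fun p _ =>
      (AxisSpectral.integrable_dirac_real g _).smul_measure ENNReal.ofReal_ne_top]
    refine Finset.sum_congr rfl fun p _ => ?_
    rw [integral_smul_measure, integral_dirac, ENNReal.toReal_ofReal (hw0 _ _), smul_eq_mul]
  refine ⟨ν, ?_, ?_, fun n => hint _, fun n hn => ?_, fun δ hδ => ?_⟩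
  · -- finite
    refine ⟨?_⟩
    rw [hνapply _ MeasurableSet.univ]
    exact ENNReal.sum_lt_top.2 fun p _ => ENNReal.mul_lt_top ENNReal.ofReal_lt_top (by simp)
  · -- no mass below `0`
    rw [hνapply _ measurableSet_Iio]
    refine Finset.sum_eq_zero fun p _ => ?_
    rw [Set.indicator_of_notMem (by simpa using hxs0 p.1 p.2), mul_zero]
  · -- moments `0 ≤ n < N`
    rw [hintegral, Fintype.sum_prod_type]
    have hval : (n : ZMod N).val = n := ZMod.val_cast_of_lt hn
    have key := hZu n
    rw [hval] at key
    have hterm : ∀ k l, w k l * xs k l ^ n = Z⁻¹ * (cc k l * (ev l ^ n * ev k ^ (N - n))) := by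
      intro k l
      simp only [hw, hxs]
      rcases (hev k).eq_or_lt with hk | hk
      · rw [← hk, zero_pow (by omega : N ≠ 0), zero_pow (by omega : N - n ≠ 0)]; simp
      · rw [div_pow]
        have hsplit : ev k ^ N = ev k ^ n * ev k ^ (N - n) := by rw [← pow_add]; congr 1; omega
        rw [hsplit]
        field_simp
    simp_rw [hterm, ← Finset.mul_sum]
    rw [← key]
    field_simp
    rfl
  · -- the no-atom bound `ν([0, δ]) ≤ B δ²`
    rw [hνapply _ measurableSet_Icc]
    have hbound : ∀ p : Layer d' N × Layer d' N,
        ENNReal.ofReal (w p.1 p.2) * (Set.Icc 0 δ).indicator 1 (xs p.1 p.2) ≤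
          ENNReal.ofReal (δ ^ 2 * (cc' p.1 p.2 * ev p.1 ^ N / Z)) := by
      rintro ⟨k, l⟩
      by_cases hmem : xs k l ∈ Set.Icc 0 δ
      · rw [Set.indicator_of_mem hmem, Pi.one_apply, mul_one]
        refine ENNReal.ofReal_le_ofReal ?_
        show cc k l * ev k ^ N / Z ≤ δ ^ 2 * (cc' k l * ev k ^ N / Z)
        rcases (hev k).eq_or_lt with hk | hk
        · rw [← hk, zero_pow (by omega : N ≠ 0)]; simp
        · have hckl : cc k l = xs k l ^ 2 * cc' k l := by
            have h := hrel k l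
            simp only [hxs]
            field_simp
            linarith [h]
          have hxδ : xs k l ^ 2 ≤ δ ^ 2 := pow_le_pow_left₀ hmem.1 hmem.2 2
          calc cc k l * ev k ^ N / Z = xs k l ^ 2 * (cc' k l * ev k ^ N / Z) := by rw [hckl]; ring
            _ ≤ δ ^ 2 * (cc' k l * ev k ^ N / Z) :=
                mul_le_mul_of_nonneg_right hxδ
                  (div_nonneg (mul_nonneg (hcc' k l) (pow_nonneg (hev k) N)) hZpos.le)
      · rw [Set.indicator_of_notMem hmem, mul_zero]; exact zero_le
    have hnn : ∀ p : Layer d' N × Layer d' N, 0 ≤ δ ^ 2 * (cc' p.1 p.2 * ev p.1 ^ N / Z) := fun p =>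
      mul_nonneg (sq_nonneg δ) (div_nonneg (mul_nonneg (hcc' _ _) (pow_nonneg (hev _) N)) hZpos.le)
    calc ∑ p : Layer d' N × Layer d' N, ENNReal.ofReal (w p.1 p.2) * (Set.Icc 0 δ).indicator 1 (xs p.1 p.2)
        ≤ ∑ p : Layer d' N × Layer d' N, ENNReal.ofReal (δ ^ 2 * (cc' p.1 p.2 * ev p.1 ^ N / Z)) :=
          Finset.sum_le_sum fun p _ => hbound p
      _ = ENNReal.ofReal (∑ p : Layer d' N × Layer d' N, δ ^ 2 * (cc' p.1 p.2 * ev p.1 ^ N / Z)) :=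
          (ENNReal.ofReal_sum_of_nonneg fun p _ => hnn p).symm
      _ ≤ ENNReal.ofReal (B * δ ^ 2) := ENNReal.ofReal_le_ofReal ?_
    rw [Fintype.sum_prod_type]
    calc ∑ k, ∑ l, δ ^ 2 * (cc' k l * ev k ^ N / Z) = δ ^ 2 * ∑ k, (ev k ^ N / Z) * ∑ l, cc' k l := by
          rw [Finset.mul_sum]
          refine Finset.sum_congr rfl fun k _ => ?_
          rw [Finset.mul_sum, Finset.mul_sum]
          refine Finset.sum_congr rfl fun l _ => ?_
          ring
      _ ≤ δ ^ 2 * ∑ k, (ev k ^ N / Z) * B := by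
          gcongr with k _
          · exact div_nonneg (pow_nonneg (hev k) N) hZpos.le
          · exact hsumcc' k
      _ = B * δ ^ 2 := by
          rw [← Finset.sum_mul, ← Finset.sum_div, ← hZev, div_self hZpos.ne']
          ring

end MixedSpectral

end Summit.CriticalPhenomena.Ising3DConformalLimit.Theorems

end
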